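import Summits.QuantumFields.YangMills.Theorems.AlphaInputsT3ACv3Pint
import Summits.QuantumFields.Balaban3D.Proofs.LiftBridge
import HarnessLib

/-!
# `AlphaInputsT3ACv3SmallFactor` — STUB 2″ clause (b) of crux `HistoryTailL` (stmt-QuantumFields-19936) AT THE v3 DATUM IN PRINT'S (= THE LANE'S) SHAPE: the per-plaquette
# small factor (69)–(71) p.273 «the part of the action (1/g_k²)A^η(U_k) localized to Δ′ … can be bounded from below by ¼p²(g_j)», PROVED from the v3 (α) rows `hLF67`/`h68` —
# with the constant `1/(4N)` of the tree's NORMALISED trace (`= ⅛` for SU(2)) and the lane's region `Run3SmallFactors.regionT` (seat finding F-α1-12) — lane `pub-balaban3d`, seat alpha-1 (g3)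

WHY THIS SHAPE (F-α1-12, evidence #53 on 19936).  The registered schema `T3AlphaInputsACSchemas.SmallFactor71` writes `¼·p(g_i)²` against the NORMALISED trace `reTr = Re Tr/N` and sums over
`plaqsIn 0 (blockAround K i p′)` (fine plaquettes with all corners in `Δ′`); print's «¼p²» is in un-normalised units, i.e. `1/(4N)` here, and the lane's Stokes step reads the fine plaquettes OF
`p′`'S ORIENTATION WITH BASE POINT in `Δ′` (`regionT`).  This file proves what print and the lane give, verbatim: §1 (lane-generic) `AlphaV3AC.eq71_perPlaquette_of_alphaV3` — for an admissible
history `h` of level `k ≤ K`, every field `U` and every recorded large-field plaquette `e = (j, p′) ∈ P(h)`: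
`p(g_j)²/4 ≤ N·((1/g_k²)·Σ_{q ∈ regionT e} η_k⁻¹[1 − reTr U_k(h,U)(∂q)])` (`PerPlaquette71.perPlaquette71_local_gamma` at the lifted minimiser, `LiftBridge.bridge_liftCfg`, the rows
`RunAlphaV3AC.hLF67`/`h68`, the threshold `γ₇₁` from `g_j ≤ γ₀`; NO averaging concordance is needed — (67) enters through the row, in [B7]'s language, by `rfl`); §2 (T³)
**`OfV3At.dataT3v3_smallFactor71_lane`**: for the v3 datum, `j ≤ K`, an admissible region history `r`, `p′ ∈ LargeP K j r i`:
`(1/8)·p(√(γL^{−(K−i)}))² ≤ β_K·Σ_{q ∈ regionT (i, plaqCode p′)} [1 − reTr U_j(r, W)(∂q)]`.  Nothing of [Balaban1985UV3] is asserted (the (α) rows are the hypothesis `OfV3At`).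

References: T. Bałaban, Commun. Math. Phys. 102 (1985) 255–275 [Balaban1985UV3] ((67)–(71) p.273); Commun. Math. Phys. 98 (1985) 17–51 [Balaban1985Averaging] ((42)–(43) p.24).
-/

set_option autoImplicit false

noncomputable section

namespace Summit.QuantumFields.YangMills.Theorems

open MeasureTheory
open scoped BigOperators Matrix.Norms.L2Operator
open Literature.MathematicalPhysics.QuantumFieldTheory.Balaban1983to89
open Literature.MathematicalPhysics.QuantumFieldTheory.Balaban1983to89.T3ContinuumYM3Torus
open Literature.MathematicalPhysics.QuantumFieldTheory.Balaban1983to89.T3UnitLawDensityEML (ℰp)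
open Literature.MathematicalPhysics.QuantumFieldTheory.Balaban1983to89.T3UnitScaleTilt (θBal)
open Literature.MathematicalPhysics.QuantumFieldTheory.Balaban1983to89.T3AlphaInputsAC
open Literature.MathematicalPhysics.QuantumFieldTheory.Balaban1985CMP102
open Literature.MathematicalPhysics.QuantumFieldTheory.Balaban1985CMP102.Setting
open Summit.QuantumFields.Balaban3D.Carriers
open Summit.QuantumFields.Balaban3D.Proofs.Primitives
open Summit.QuantumFields.Balaban3D.Proofs.ScalesArithmetic (gk_pos gk_le_one gk_sq g0sq_pos gk_eq_gRun_norm)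
open Summit.QuantumFields.Balaban3D.Proofs.GroupModelLieC (lieC)
open Summit.QuantumFields.Balaban3D.Proofs.FamilyLE (thresholds_of_le)
open Summit.QuantumFields.Balaban3D.Proofs.TowerAC
open Summit.QuantumFields.Balaban3D.Proofs.StandardAC
open Summit.QuantumFields.Balaban3D.Proofs.InputsAC
open Summit.QuantumFields.Balaban3D.Proofs.AlphaAC (AlphaDataAC)
open Summit.QuantumFields.Balaban3D.Proofs.TorusLift (projSite zOf projSite_injOn_deltaBox)
open Summit.QuantumFields.Balaban3D.Proofs.LiftBridge (liftCfg liftCfg_mem_unitaryUnits bridge_liftCfg)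
open Summit.QuantumFields.Balaban3D.Proofs.Run3SmallFactors (codeZ regionT decode_of_mem_disc)
open Summit.QuantumFields.Balaban3D.Proofs.PerPlaquette71 (perPlaquette71_local_gamma)
open B7Prop1Explicit (hol plaqWord)
open B7Prop2Explicit (avgIter)
open B10Eq70Squaring (deltaBox)

/-! ## §1 (71) per recorded plaquette for the AC tower of a v3 package -/

namespace AlphaV3AC

variable {L : ℕ} {S : Scales L} {G : Type} [GaugeGroup G] [MeasurableSpace G] [HaarData G] {𝔊 : GroupModel G} {𝔠 : AlphaConsts L 𝔊.N}
  {X : ExternalInputsAC S G} {𝔖 : ∀ k, StepSeries S G ↥(lieC 𝔊) (nblkOf S 𝔠.lane.carrier k) k} {𝔄 : AlphaDataAC 𝔊 𝔠 X 𝔖}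
  {win : (k : ℕ) → Hist S.P (k + 1) → Set (GaugeField S.P (k + 1) G)}
  (hle : S.g ^ 2 * S.ε₀ ≤ (min 𝔠.gamma0 1) ^ 2)
include hle

/-- **(71) PER RECORDED LARGE-FIELD PLAQUETTE, FOR THE AC TOWER OF A v3 PACKAGE** (p.273 L11–22; the `h71` of `Run3SmallFactors.smallFactorsAdm_tower3` for ONE plaquette,
from the v3 rows): on the `≤`-family, for `k ≤ K`, an ADMISSIBLE history `h`, every field `U` and every `e = (j, code p′) ∈ P(h)`,
`p(g_j)²/4 ≤ N·((1/g_k²)·Σ_{q ∈ regionT e} η_k⁻¹[1 − reTr U_k(h,U)(∂q)])` — `PerPlaquette71.perPlaquette71_local_gamma` at the lifted composite minimiser `liftCfg 𝔊 (U_k(h,U))` with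
`V_j := Ū^j` (so (67) by `rfl`), the large-field row `hLF67`, the regularity row `h68`, the threshold `γ₇₁` (`FamilyLE.thresholds_of_le`), the running coupling `g_i = gRun 1 L g₀² i`, and the
plaquette bridge `LiftBridge.bridge_liftCfg` (the box sum over `deltaBox` = the sum over the torus region `regionT e`, `projSite` injective on the box). [cite: Balaban1985UV3, (67)–(71) p.273] -/
theorem eq71_perPlaquette_of_alphaV3 (hL : 2 ≤ L) (R : RunAlphaV3AC 𝔊 𝔠 X 𝔖 𝔄 win) (k : ℕ) (hk : k ≤ S.K) (h : Hist S.P k)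
    (hh : Hist.Admissible 𝔠.lane.carrier.M₁ (rcolOf S 𝔠.lane.carrier) k h) (U : GaugeField S.P k G) (e : ℕ × PlaqCode S.P)
    (he : e ∈ Hist.disc h) :
    B10.pFun 𝔠.lane.carrier.b₀ 𝔠.lane.carrier.p₀ (S.gk e.1) ^ 2 / 4 ≤
      (𝔊.N : ℝ) * ((S.gk k)⁻¹ ^ 2 * ∑ q ∈ regionT e, (S.eta k)⁻¹ * (1 - reTr (GaugeField.plaqHol (X.UkH k h U) q))) := by
  classical
  haveI : NeZero 𝔊.N := ⟨Nat.pos_iff_ne_zero.mp 𝔊.N_pos⟩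
  obtain ⟨j, hj, p', hp', hej, hz, hμ, hν⟩ := decode_of_mem_disc he
  have hμν : e.2.2.1 < e.2.2.2 := by rw [hμ, hν]; exact p'.hμν
  have he1 : e.1 = j := by rw [hej]
  have key := perPlaquette71_local_gamma L hL one_pos (g0sq_pos S) 𝔠.lane.F.b₀_pos 𝔠.lane.F.p₀_pos 𝔠.C68_pos S.gk
    (gk_eq_gRun_norm S) (j := e.1) (k := k) (by omega) ((thresholds_of_le hle e.1 (by omega)).2.2.2.1)
    (liftCfg 𝔊 (X.UkH k h U)) (avgIter L (liftCfg 𝔊 (X.UkH k h U)) e.1) (fun x κ => liftCfg_mem_unitaryUnits 𝔊 _ x κ)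
    (codeZ e) (ne_of_lt hμν) rfl (R.hLF67 k hk h hh U e he) (R.h68 k hk h hh U e he)
  refine key.trans (le_of_eq ?_)
  congr 1
  congr 1
  have h2 : 2 * L ^ e.1 ≤ S.P.sitesPerDir 0 := by
    show 2 * L ^ e.1 ≤ 2 * L ^ (S.m + S.K - 0)
    rw [Nat.sub_zero]
    exact Nat.mul_le_mul_left 2 (Nat.pow_le_pow_right (by omega) (by omega))
  unfold Summit.QuantumFields.Balaban3D.Proofs.Run3SmallFactors.regionT
  rw [dif_pos hμν, @Finset.sum_image _ _ _ _ _ (instDecidableEqPlaq (P := S.P) (j := 0)) _ _ ?inj]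
  · refine Finset.sum_congr rfl fun y _ => ?_
    exact (bridge_liftCfg 𝔊 k (X.UkH k h U) y hμν).symm
  · intro y hy y' hy' hyy
    exact projSite_injOn_deltaBox h2 _ _ _ hy hy' (congrArg Plaq.src hyy)

omit hle in
/-- `(1/g_k²)·η_k⁻¹ = 1/g₀²` at every level (`g_k² = g²Lᵏε`, `η_k = L^{−k}`). [cite: Balaban1985UV3, (5) p.256] -/
theorem inv_gk_sq_mul_inv_eta (k : ℕ) : (S.gk k)⁻¹ ^ 2 * (S.eta k)⁻¹ = 1 / S.g0sq := by
  have hL : (0 : ℝ) < L := by exact_mod_cast (zero_lt_one.trans S.hL.2)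
  have hLk : (0 : ℝ) < (L : ℝ) ^ k := pow_pos hL k
  have hgk : S.gk k ^ 2 = S.g ^ 2 * ((L : ℝ) ^ k * S.ε) := gk_sq S k
  have heta : S.eta k = ((L : ℝ)⁻¹) ^ k := rfl
  rw [heta]
  simp only [inv_pow, inv_inv]
  rw [hgk]
  unfold Scales.g0sq
  have hg : S.g ≠ 0 := S.g_pos.ne'
  have hε : S.ε ≠ 0 := S.ε_pos.ne'
  field_simp

end AlphaV3AC

/-! ## §2 At the T³ package: clause (b) for the v3 datum in print's shape -/

section T3

variable {F : T3Family} {𝔠 : AlphaConsts F.L (suGroupModel 2).N} {a₀ a₁ : ℝ}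
  (h : AlphaInputsT3AC.OfV3At F 𝔠 a₀ a₁) (hc : 0 < a₀ ∧ 0 < a₁ ∧ 𝔠.B₃ * a₁ ≤ a₀) (γ : ℝ) (hγ : 0 < γ)
  (hγ1 : γ ≤ (min 𝔠.gamma0 1) ^ 2) (π : AlphaInputsT3AC.PolymerT3 F)

/-- **STUB 2″ CLAUSE (b) AT THE v3 DATUM IN PRINT'S SHAPE — PROVED** (F-α1-12): for every run `K`, level `j ≤ K`, region history `r` whose assembled pair is charged (so `r` is admissible),
fibre variable `v`, field `W`, and every large-field plaquette `p′ ∈ LargeP K j r i` (so `i < j`, `p′ ∈ P_i(r)`):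
`(1/8)·p(g_i)² ≤ β_K · Σ_{q ∈ regionT (i, plaqCode p′)} [1 − reTr U_j(r, W)(∂q)]`, `g_i = √(γL^{−(K−i)})`, `reTr` the NORMALISED trace (so `1/8 = 1/(4N)` at `N = 2` is print's «¼p²»),
`regionT` = the fine plaquettes of `p′`'s orientation based in the four `i`-blocks `Δ′(p′)` — `AlphaV3AC.eq71_perPlaquette_of_alphaV3` at the v3 record with `(1/g_j²)η_j⁻¹ = β_K`.
[cite: Balaban1985UV3, (67)–(71) p.273] -/
theorem AlphaInputsT3AC.OfV3At.dataT3v3_smallFactor71_lane (K j : ℕ) (r : (h.lfDataT3v3 hc γ hγ hγ1 π).Reg K j)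
    (v : (i : Fin j) → GaugeField (F.P K) i (Matrix.specialUnitaryGroup (Fin 2) ℂ)) (W : GaugeField (F.P K) j (Matrix.specialUnitaryGroup (Fin 2) ℂ))
    (hj : j ≤ K) (hadm : (h.dataT3v3 hc γ hγ hγ1 π).Adm K j ((h.lfDataT3v3 hc γ hγ hγ1 π).assemble K j r v) W)
    (i : ℕ) (p' : Plaq (F.P K) i) (hp : p' ∈ (h.lfDataT3v3 hc γ hγ hγ1 π).LargeP K j r i) :
    (1 / 8 : ℝ) * B10.pFun 𝔠.b₀ 𝔠.p₀ (Real.sqrt (γ * ((F.L : ℝ)⁻¹) ^ (K - i))) ^ 2 ≤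
      (F.scheme ℰp γ).β K * ∑ q ∈ regionT (S := T3Scales F γ hγ (hγ1.trans (sq_min_one_le _ 𝔠.gamma0_pos)) K) ((i, plaqCode p') : ℕ × PlaqCode (F.P K)),
        (1 - reTr (GaugeField.plaqHol ((h.dataT3v3 hc γ hγ hγ1 π).Umin K j ((h.lfDataT3v3 hc γ hγ hγ1 π).assemble K j r v) W) q)) := by
  have hγ1' : γ ≤ 1 := hγ1.trans (sq_min_one_le _ 𝔠.gamma0_pos)
  have hij := (h.lfDataT3v3_largeP_geom hc γ hγ hγ1 π K j hj r v i p' hp).1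
  have hr : Hist.Admissible 𝔠.lane.carrier.M₁ (rcolOf (T3Scales F γ hγ hγ1' K) 𝔠.lane.carrier) j r := hadm.1
  have hp' : p' ∈ r ⟨i, hij⟩ := by
    rw [h.lfDataT3v3_largeP_of_admissible hc γ hγ hγ1 π K j r hr i hij] at hp
    exact hp
  have he : ((i, plaqCode p') : ℕ × PlaqCode (F.P K)) ∈ Hist.disc r := (Hist.mem_disc r _).2 ⟨⟨i, hij⟩, p', hp', rfl⟩
  have hL : 2 ≤ F.L := F.hL.2
  -- the running coupling at level `i` and the prefactor `(1/g_j²)η_j⁻¹ = β_K`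
  have hgi : (T3Scales F γ hγ hγ1' K).gk i = Real.sqrt (γ * ((F.L : ℝ)⁻¹) ^ (K - i)) := T3Scales_gk_eq F γ hγ hγ1' K i (by omega)
  have hβ : ((T3Scales F γ hγ hγ1' K).gk j)⁻¹ ^ 2 * ((T3Scales F γ hγ hγ1' K).eta j)⁻¹ = (F.scheme ℰp γ).β K := by
    rw [AlphaV3AC.inv_gk_sq_mul_inv_eta, T3Scales_inv_g0sq_eq]
  have hsum : ((T3Scales F γ hγ hγ1' K).gk j)⁻¹ ^ 2 *
      ∑ q ∈ regionT (S := T3Scales F γ hγ hγ1' K) ((i, plaqCode p') : ℕ × PlaqCode (F.P K)),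
        ((T3Scales F γ hγ hγ1' K).eta j)⁻¹ * (1 - reTr (GaugeField.plaqHol ((h.pkgAtV3 hc γ hγ hγ1 K).UkH j r W) q)) =
      (F.scheme ℰp γ).β K * ∑ q ∈ regionT (S := T3Scales F γ hγ hγ1' K) ((i, plaqCode p') : ℕ × PlaqCode (F.P K)),
        (1 - reTr (GaugeField.plaqHol ((h.pkgAtV3 hc γ hγ hγ1 K).UkH j r W) q)) := by
    rw [← hβ, Finset.mul_sum, Finset.mul_sum]
    refine Finset.sum_congr rfl fun q _ => ?_
    ring
  have hN : ((suGroupModel 2).N : ℝ) = 2 := by norm_num [suGroupModel]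
  have h71 : B10.pFun 𝔠.b₀ 𝔠.p₀ ((T3Scales F γ hγ hγ1' K).gk i) ^ 2 / 4 ≤
      ((suGroupModel 2).N : ℝ) * (((T3Scales F γ hγ hγ1' K).gk j)⁻¹ ^ 2 *
        ∑ q ∈ regionT (S := T3Scales F γ hγ hγ1' K) ((i, plaqCode p') : ℕ × PlaqCode (F.P K)),
          ((T3Scales F γ hγ hγ1' K).eta j)⁻¹ * (1 - reTr (GaugeField.plaqHol ((h.pkgAtV3 hc γ hγ hγ1 K).UkH j r W) q))) :=
    AlphaV3AC.eq71_perPlaquette_of_alphaV3 (T3Scales_window F 𝔠 γ hγ hγ1 K) hL (h.pkgAtV3 hc γ hγ hγ1 K).run j hj r hr W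
      (i, plaqCode p') he
  rw [hsum, hN, hgi] at h71
  show (1 / 8 : ℝ) * B10.pFun 𝔠.b₀ 𝔠.p₀ (Real.sqrt (γ * ((F.L : ℝ)⁻¹) ^ (K - i))) ^ 2 ≤
    (F.scheme ℰp γ).β K * ∑ q ∈ regionT (S := T3Scales F γ hγ hγ1' K) ((i, plaqCode p') : ℕ × PlaqCode (F.P K)),
      (1 - reTr (GaugeField.plaqHol ((h.pkgAtV3 hc γ hγ hγ1 K).UkH j r W) q))
  linarith

end T3

end Summit.QuantumFields.YangMills.Theorems

end
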